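import Mathlib.Topology.Algebra.Category.ProfiniteGrp.Completion
import Mathlib.GroupTheory.FreeGroup.Basic
import Literature.AnabelianGeometry.SemiGraphs.TemperedAnabelian
import Literature.AnabelianGeometry.SemiGraphs.ProfiniteCompletionCoordinates
import Literature.AnabelianGeometry.SemiGraphs.FreeGroupConjugatesInCompletion
import Literature.GroupTheory.CombinatorialGroupTheory.FreeGroupResiduallyFinite
import HarnessLib

/-!
# [SemiAnbd] Lemma 6.1 (i): a free group of rank `> 1` is its own normaliser in its profinite completion

Companion (theorems only) of `Literature/AnabelianGeometry/SemiGraphs/TemperedAnabelian.lean`: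
discharge of the named fact `FreeGroupNormallyTerminalInCompletion` — Mochizuki, *Semi-graphs of
anabelioids*, Publ. RIMS 42 (2006), Lemma 6.1 (i), p. 69: "Let `F` be a finitely generated free
group of rank `> 1`. Then `N_{F̂}(F) = F`."  (abc-iut node `SemiAnbd:Lem6.1(i)`, DISCHARGE-L3
item G14.)  The printed proof cites [André, Lemma 3.2.1] (conjugacy separability + centralisers of
basis elements + an exponent lemma); OUR proof is a different, elementary route:

1. (`exists_mulEquiv_of_mem_normalizer`) an element `g` of the normaliser induces, by residual
   finiteness of `F` (tree: `freeGroup_residuallyFinite`) and injectivity of `ι : F → F̂`, an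
   automorphism `φ` of `F` with `ι(φ f) = g ι(f) g⁻¹`;
2. (`FreeGroupConjugatesInCompletion.lean`) for each basis element `x_i`, the Fox-cocycle /
   coset-sum argument and M. Hall's separability of cyclic subgroups give
   `g ∈ cl(ι⟨φ x_i⟩)·ι(u_i)` for some `u_i ∈ F`;
3. (`ProfiniteCompletionCoordinates.lean`) since `φ x₀, φ x₁` extend to a basis, the homomorphism
   `ψ = (e₀, e₁) ∘ φ⁻¹ : F → ℤ²` separates them, and the closures `cl ι⟨φ x₀⟩`, `cl ι⟨φ x₁⟩` meet
   `ι(F)`-translates rigidly: `a⁻¹ b ∈ ι(F)` with `a ∈ cl ι⟨φ x₀⟩`, `b ∈ cl ι⟨φ x₁⟩` forces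
   `a ∈ ι⟨φ x₀⟩`; hence `g ∈ ι(F)`.

Nothing here concerns the disputed parts of IUT; this is classical combinatorial group theory,
kernel-checked. [cite: MochizukiSemiAnbd2006, Lem. 6.1(i) p.69]
-/

namespace Literature.AnabelianGeometry.SemiGraphs

open CategoryTheory ProfiniteGrp ProfiniteGrp.ProfiniteCompletion
open Literature.GroupTheory.CombinatorialGroupTheory

universe u

/-- An element of `F̂` normalising the image of the free group `F` induces an automorphism of `F`
(conjugation by `g`, pulled back along the injective map `ι : F → F̂`). [folklore] -/
private theorem exists_mulEquiv_of_mem_normalizer {α : Type u}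
    (g : completion (GrpCat.of (FreeGroup α)))
    (hg : g ∈ Subgroup.normalizer
      ((toProfiniteCompletion (FreeGroup α)).range : Set (completion (GrpCat.of (FreeGroup α))))) :
    ∃ φ : FreeGroup α ≃* FreeGroup α, ∀ f, toProfiniteCompletion (FreeGroup α) (φ f) =
      g * toProfiniteCompletion (FreeGroup α) f * g⁻¹ := by
  set ι := toProfiniteCompletion (FreeGroup α) with hι
  haveI := freeGroup_residuallyFinite α
  have hinj : Function.Injective ι := toProfiniteCompletion_injective
  have hmem : ∀ f : FreeGroup α, g * ι f * g⁻¹ ∈ ι.range := fun f =>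
    ((Subgroup.mem_normalizer_iff).1 hg (ι f)).1 ⟨f, rfl⟩
  choose φf hφf using fun f => MonoidHom.mem_range.1 (hmem f)
  have hmul : ∀ x y, φf (x * y) = φf x * φf y := fun x y => hinj (by
    rw [hφf, map_mul, map_mul, hφf, hφf]
    group)
  let φh : FreeGroup α →* FreeGroup α := MonoidHom.mk' φf hmul
  have hφh : ∀ f, φh f = φf f := fun _ => rfl
  have hφinj : Function.Injective φh := fun x y hxy => by
    apply hinj
    have h1 : ι (φf x) = ι (φf y) := by rw [← hφh, ← hφh, hxy]
    rw [hφf, hφf] at h1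
    exact mul_left_cancel (mul_right_cancel h1)
  have hφsurj : Function.Surjective φh := fun y => by
    have hy : g⁻¹ * ι y * g ∈ ι.range := by
      refine ((Subgroup.mem_normalizer_iff).1 hg (g⁻¹ * ι y * g)).2 ?_
      have e : g * (g⁻¹ * ι y * g) * g⁻¹ = ι y := by group
      rw [e]
      exact ⟨y, rfl⟩
    obtain ⟨x, hx⟩ := MonoidHom.mem_range.1 hy
    refine ⟨x, hinj ?_⟩
    rw [hφh, hφf, hx]
    group
  exact ⟨MulEquiv.ofBijective φh ⟨hφinj, hφsurj⟩, fun f => hφf f⟩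

/-- **[SemiAnbd] Lemma 6.1 (i)** (Mochizuki 2006, p. 69; proof in print: [André, Lem. 3.2.1]):
for a free group `F` of finite rank `n > 1`, the image of `F` in its profinite completion `F̂` is
its own normaliser, `N_{F̂}(F) = F`.  Discharges the named fact
`FreeGroupNormallyTerminalInCompletion` by the route described in the module docstring
(Fox cocycle + coset sums + M. Hall separability + residual finiteness; no conjugacy
separability is used). [cite: MochizukiSemiAnbd2006, Lem. 6.1(i) p.69] -/
theorem FreeGroupNormallyTerminalInCompletion_holds : FreeGroupNormallyTerminalInCompletion := by
  intro n hn
  set ι := toProfiniteCompletion (FreeGroup (Fin n)) with hι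
  refine le_antisymm ?_ Subgroup.le_normalizer
  intro g hg
  -- two distinct basis elements
  let i₀ : Fin n := ⟨0, by omega⟩
  let i₁ : Fin n := ⟨1, hn⟩
  have h10 : i₁ ≠ i₀ := by simp [i₀, i₁, Fin.ext_iff]
  -- the induced automorphism and the images of the two basis elements
  obtain ⟨φ, hφ⟩ := exists_mulEquiv_of_mem_normalizer g hg
  set y₁ := φ (FreeGroup.of i₀) with hy₁
  set y₂ := φ (FreeGroup.of i₁) with hy₂
  -- the separating homomorphism `ψ = (e₀, e₁) ∘ φ⁻¹`
  let ψ₀ : FreeGroup (Fin n) →* Multiplicative (ℤ × ℤ) := FreeGroup.lift fun i =>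
    if i = i₀ then Multiplicative.ofAdd (1, 0)
    else if i = i₁ then Multiplicative.ofAdd (0, 1) else 1
  let ψ : FreeGroup (Fin n) →* Multiplicative (ℤ × ℤ) := ψ₀.comp φ.symm.toMonoidHom
  have hψ₁ : ψ y₁ = Multiplicative.ofAdd (1, 0) := by
    simp [ψ, ψ₀, hy₁]
  have hψ₂ : ψ y₂ = Multiplicative.ofAdd (0, 1) := by
    simp [ψ, ψ₀, hy₂, h10]
  -- step 2 for both basis elements
  obtain ⟨u₁, hu₁⟩ := exists_forall_coord_mul_inv_mem_zpowers i₀ g y₁ (hφ _)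
  obtain ⟨u₂, hu₂⟩ := exists_forall_coord_mul_inv_mem_zpowers i₁ g y₂ (hφ _)
  have hA : g * (ι u₁)⁻¹ ∈ ((Subgroup.zpowers y₁).map ι).topologicalClosure :=
    (mem_topologicalClosure_map_iff _ _).2 hu₁
  have hB : g * (ι u₂)⁻¹ ∈ ((Subgroup.zpowers y₂).map ι).topologicalClosure :=
    (mem_topologicalClosure_map_iff _ _).2 hu₂
  -- step 3: rigidity of the two closures against `ι(F)`
  have hA' : (g * (ι u₁)⁻¹)⁻¹ ∈ ((Subgroup.zpowers y₁).map ι).topologicalClosure :=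
    Subgroup.inv_mem _ hA
  have hprod : (g * (ι u₁)⁻¹)⁻¹ * (g * (ι u₂)⁻¹) ∈ ι.range :=
    ⟨u₁ * u₂⁻¹, by rw [map_mul, map_inv]; group⟩
  haveI := freeGroup_residuallyFinite (Fin n)
  obtain ⟨z, -, hz⟩ := mem_image_zpowers_of_mul_mem_range ψ y₁ y₂ hψ₁ hψ₂ hA' hB hprod
  refine ⟨z⁻¹ * u₁, ?_⟩
  rw [map_mul, map_inv, hz]
  group

end Literature.AnabelianGeometry.SemiGraphs
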